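import Literature.MathematicalPhysics.QuantumFieldTheory.Balaban1983to89.B8Eq191FlatDirichletDistance
import Literature.MathematicalPhysics.QuantumFieldTheory.Balaban1983to89.B8Eq191FlatDirichletConjugation

/-!
# `Balaban1983to89.B8Eq191FlatDirichletDepth` — [Balaban1984PropagatorsII] (2.2) p. 224 ∕ (2.46) p. 231 ∕ Lemma 2.1 p. 234 ON THE CUBE MEMBER `{□_j}` of
# [Balaban1985RegularSpaces] (1.131): the DEPTH of a site into the nested cubes, the DEPTH POTENTIAL `F = Σ_l L⁻ˡ·min(ρLˡ, depth_l)`, and THE COLLAR LOWER BOUND of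
# the tower-scaled site distance of `B8Eq191FlatDirichletDistance` — `d_σ(x, z) ≥ ρ·(|j(x) − j(z)| − 1)`: every nearest-neighbour walk between sites of tower levels
# `j(x)`, `j(z)` crosses the full collars between them, each `ρ = R₁M₁` coarse blocks thick (brick 4b of the (R1′) programme of DAG node N05)

statement-level skeleton of published theorems with citation tags; proofs where landed; nothing here is a claim about the
Yang–Mills mass gap

T. Bałaban, *Propagators and renormalization transformations for lattice gauge theories. II*, Commun. Math. Phys. **96** (1984) 223–250 `[Balaban1984PropagatorsII]`
("B6"): (2.2) p. 224 («(Lʲη)⁻¹ dist(Ω_jᶜ, Ω_{j+1}) > RM, M is a size of big blocks and R is a big positive integer fixed later»), (2.46) p. 231 (the block distance),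
Lemma 2.1 (2.60)–(2.61) p. 234; T. Bałaban, *Spaces of regular gauge field configurations …*, Commun. Math. Phys. **99** (1985) 75–102 `[Balaban1985RegularSpaces]`
("B8"): p. 98 («Let us take a sequence of cubes □₀, □₁, …, □_{k−1}, □_k, □, such that □_j ⊃ □_{j+1} and a distance between boundaries of these cubes is equal to
R₁M₁Lʲη»), (1.131) p. 99, (1.5)–(1.6) p. 77.

CITATION HEADER (lean-in-tree rule).  Cell `pub-ymgap` (YM Track A, HUMAN RULING D-0062), DAG node N05 = [B8], seat `pub-ymgap-dag-n05-c` (g8), programme (R1′)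
(memo `R1PRIME-PROGRAMME.md`, seat HOME).  Bricks 1–3 (`B8Eq191FlatDirichletCoercive ∕ Conjugation ∕ LipschitzExponent`) give the weighted-`ℓ²` decay of the flat
Dirichlet multi-level Green's function in the weights `e^{±δ′ d}` for any bond-Lipschitz exponent; brick 4a (`B8Eq191FlatDirichletDistance`) supplies the tower-scaled site
distance `d_σ` and the test-function principle.  THIS FILE is brick 4b: the first LOWER bound of `d_σ` on the cube member — the DEPTH (inter-collar) growth — proved by
exhibiting a bond-Lipschitz potential.  (The lateral growth inside a collar and the counting `sup_x Σ_z e^{−αd_σ(x,z)}·weights ≤ C` of [B6] Lemma 2.1 (2.61), where the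
margin threshold «R is a big positive integer» of bus LOCATED-ρ enters, are brick 4c.)

WHAT IS DECLARED ∕ PROVED.
* §1 defs `fm L ρ k j` (the fine margin `m_j = Lʲ·ρ·Σ_{i≤k−j}Lⁱ` of `□_j`; `fm_succ` = `B8Eq131Cubes.margin_succ`: `m_j = m_{j+1} + ρLʲ`; `fm_add_le`), `loC ∕ hiC` (fine corners of
  `□_j`), `depth` (`max 0 (min_i min(z_i − lo_i + 1, hi_i + 1 − z_i))`, `d ≥ 1`); `mem_cube_iff_inBox` (`□_j = [loC_j, hiC_j]` by `tlo_bLo ∕ thi_bHi`).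
* §2 ★ `mem_cube_iff_one_le_depth` (`z ∈ □_j ⟺ depth_j z ≥ 1`), ★ `abs_depth_sub_depth_le_one` (one lattice step changes the depth by ≤ 1), ★★ `depth_ge_of_mem_inner`
  (a site of `□_{j′}`, `j < j′ ≤ k`, lies `≥ ρLʲ + 1` deep in `□_j` — the printed collar width).
* §3 the TOWER LEVEL versus the cubes: `mem_cube_of_tower` (level `j` ⇒ `∈ □_j`), ★ `not_mem_cube_succ_of_tower` (level `j < n` ⇒ `∉ □_{j+1}`, via `inner_eq_blowup`:
  `□_{j+1}` is the `Lʲ`-blow-up of the inner box), `mem_cube_of_le_tower`, `not_mem_cube_of_tower_lt`.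
* §4 def `pot` (the depth potential `F`); `term_eq_cap ∕ term_eq_cap_of_close ∕ term_eq_zero ∕ abs_term_sub_term_le`; ★★ **`abs_pot_sub_pot_le`** — `F` is BOND-LIPSCHITZ
  AT THE TOWER SCALE: `|F(z₁) − F(z₀)| ≤ L⁻ʲ` for `z₀` of level `j` and any depth-close `z₁` (terms `l < j` capped at both sites, `l > j + 1` zero at both, at most one of
  `l = j, j + 1` moves); ★ `pot_bounds` (`ρ·j ≤ F(z) ≤ ρ·(j + 1)` at level `j`).
* §5 ★ `pot_testFunction` (`|F u − F v| ≤ min(σ u, σ v)` across the bonds of `□₀`, `σ` the tower scale — the hypothesis of brick 4a's `abs_sub_le_lsDist`),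
  `reachable_of_inBox` ∕ `reachable_cubeMember` (a box is connected in the region graph), ★★★ **`lsDist_ge_collars`**:
  `ρ·(|jₓ − j_z| − 1) ≤ d_σ(x, z)` for `x, z ∈ □₀` of tower levels `jₓ, j_z ≤ n`.

HONEST SCOPE.  Lattice geometry of the printed cube family; NO analytic estimate.  With bricks 1–4a this gives, for the flat Dirichlet multi-level Green's function on the
cube member, the INTER-COLLAR decay `e^{−2δ′ρ·(#collars − 1)}` in weighted `ℓ²` (take `ρ(z) = −δ′·d_σ(x₀, z)` in `agmon_solve_cubeMember_of_lipschitz` ∘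
`lipschitz_of_towerDist` and bound `e^{2ρ}` by this file).  NOT (1.101): the LATERAL decay inside a collar (sites far apart in one collar are joined through the coarser
interior at cost `≈ 2ρ·log_L` of the lateral separation — a genuinely weaker, power-law growth) and the counting lemma are brick 4c; the `ℓ² → ℓ^∞` step is brick 5.
Count-neutral; N05 NOT discharged; one finite `T⁴` programme at fixed `ε`, Bałaban as printed; nothing continuum ∕ ℝ⁴ ∕ OS ∕ mass-gap ∕ Clay.  No `sorry`, no `instance`,
no `notation`; five `def`s (`fm`, `loC`, `hiC`, `depth`, `pot`).  Unit `pub-ymgap-dag-n05-c` (g8), 2026-08-27.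

RELATED IN THE TREE, NOT DUPLICATED: `B8Eq131Cubes` (the cube family's corners∕margins `bLo ∕ bHi ∕ gs ∕ margin_succ ∕ inner_eq_blowup`, USED), `B8CubeMemberZd` ∕
`B8Eq191FlatLettersCubeMember` (tower sets `cubeLamS`, `towers_disjoint_cube`, `hpart_cubeLam`, USED via bricks 1–2), `B6Geom246MultiLevelBox ∕ …Torus` (p21: (2.46) and
Lemma 2.1 on the Neumann-box ∕ torus BLOCK carriers — other carriers; their `K261`∕`theta_lt_one_of_log` counting is the model for brick 4c), `B6Ineq261LevelGap`.
-/

noncomputable section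

namespace Literature.MathematicalPhysics.QuantumFieldTheory.Balaban1983to89.B8Eq191FlatDirichletDepth

open Finset
open B7Prop1Explicit (e)
open B7Prop1Local (InBox)
open B8Eq131Cubes (gs bLo bHi cube sqLo sqHi tlo_bLo thi_bHi margin_succ one_le_gs)
open Literature.MathematicalPhysics.QuantumLattice (blockMap)

variable {d : ℕ}

/-! ## §1 The fine margins and corners of the nested cubes `□_j`, and the depth of a site into `□_j` -/

/-- The fine margin `m_j = Lʲ·R₁M₁·Σ_{i ≤ k−j} Lⁱ` of `□_j` around `□^{(k)}` (B8 p. 98: «a distance between boundaries of these cubes is equal to R₁M₁Lʲη»).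
[cite: Balaban1985RegularSpaces, p.98, (1.131) p.99] -/
def fm (L ρ k j : ℕ) : ℕ := L ^ j * (ρ * gs L (k - j))

/-- Lower fine corner of `□_j`. [cite: Balaban1985RegularSpaces, p.98] -/
def loC (L : ℕ) (a : Fin d → ℤ) (ρ k j : ℕ) : Fin d → ℤ := bLo L a k (fm L ρ k j)

/-- Upper fine corner of `□_j`. [cite: Balaban1985RegularSpaces, p.98] -/
def hiC (L : ℕ) (a : Fin d → ℤ) (M ρ k j : ℕ) : Fin d → ℤ := bHi L a M k (fm L ρ k j)

/-- **The depth of a site into `□_j`**: the number of lattice steps needed to leave `□_j` in the `ℓ^∞` sense, `min_i min(z_i − lo_i + 1, hi_i + 1 − z_i)`, clamped at `0`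
outside (`d ≥ 1`). [cite: Balaban1984PropagatorsII, (2.46) p.231; Balaban1985RegularSpaces, p.98] -/
def depth (hd : 0 < d) (L : ℕ) (a : Fin d → ℤ) (M ρ k j : ℕ) (z : Fin d → ℤ) : ℤ :=
  max 0 ((Finset.univ : Finset (Fin d)).inf' ⟨⟨0, hd⟩, Finset.mem_univ _⟩
    fun i => min (z i - loC L a ρ k j i + 1) (hiC L a M ρ k j i + 1 - z i))

/-- The successive margins differ by `ρ·Lʲ`: `m_j = m_{j+1} + ρLʲ` (`j < k`). [cite: Balaban1985RegularSpaces, p.98] -/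
theorem fm_succ {L ρ k j : ℕ} (hj : j < k) : fm L ρ k j = fm L ρ k (j + 1) + ρ * L ^ j := margin_succ hj

/-- The margins decrease inwards: `m_{j'} + ρ·Lʲ ≤ m_j` for `j < j' ≤ k`. [cite: Balaban1985RegularSpaces, p.98] -/
theorem fm_add_le {L ρ k j j' : ℕ} (hjj : j < j') (hj' : j' ≤ k) : fm L ρ k j' + ρ * L ^ j ≤ fm L ρ k j := by
  induction j' with
  | zero => exact absurd hjj (Nat.not_lt_zero _)
  | succ i ih =>
    rcases Nat.lt_succ_iff_lt_or_eq.mp hjj with hlt | heq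
    · have h1 := ih hlt (Nat.le_of_succ_le hj')
      have h2 : fm L ρ k i = fm L ρ k (i + 1) + ρ * L ^ i := fm_succ (Nat.lt_of_succ_le hj')
      omega
    · subst heq
      rw [fm_succ (Nat.lt_of_succ_le hj')]

/-- `□_j` IS the fine box `[loC_j, hiC_j]` (`j ≤ k`). [cite: Balaban1985RegularSpaces, (1.131) p.99, p.98] -/
theorem mem_cube_iff_inBox {L : ℕ} (a : Fin d → ℤ) (M ρ : ℕ) {k j : ℕ} (hj : j ≤ k) (z : Fin d → ℤ) :
    z ∈ cube L a M ρ k j ↔ InBox (loC L a ρ k j) (hiC L a M ρ k j) z := by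
  have h1 : B8Ineq130.tlo L (sqLo L a ρ k j) j = loC L a ρ k j := by
    unfold sqLo loC fm; rw [tlo_bLo, Nat.sub_add_cancel hj]
  have h2 : B8Ineq130.thi L (sqHi L a M ρ k j) j = hiC L a M ρ k j := by
    unfold sqHi hiC fm; rw [thi_bHi, Nat.sub_add_cancel hj]
  show InBox _ _ z ↔ _
  rw [h1, h2]

/-! ## §2 Depth: membership, the one-step Lipschitz property, and the collar relations -/

/-- `z ∈ □_j` iff `depth_j(z) ≥ 1`. [cite: Balaban1985RegularSpaces, p.98] -/
theorem mem_cube_iff_one_le_depth (hd : 0 < d) {L : ℕ} (a : Fin d → ℤ) (M ρ : ℕ) {k j : ℕ} (hj : j ≤ k) (z : Fin d → ℤ) :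
    z ∈ cube L a M ρ k j ↔ 1 ≤ depth hd L a M ρ k j z := by
  rw [mem_cube_iff_inBox a M ρ hj z]
  unfold depth InBox
  rw [le_max_iff, Finset.le_inf'_iff]
  constructor
  · intro h
    right
    intro i _
    obtain ⟨h1, h2⟩ := h i
    rw [le_min_iff]; constructor <;> linarith
  · rintro (h | h)
    · exact absurd h (by norm_num)
    · intro i
      have hi := h i (Finset.mem_univ i)
      rw [le_min_iff] at hi
      constructor <;> linarith [hi.1, hi.2]

/-- One lattice step changes the depth by at most `1`. [cite: Balaban1984PropagatorsII, (2.46) p.231] -/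
theorem abs_depth_sub_depth_le_one (hd : 0 < d) (L : ℕ) (a : Fin d → ℤ) (M ρ k j : ℕ) (z : Fin d → ℤ) (μ : Fin d) :
    |depth hd L a M ρ k j (z + e μ) - depth hd L a M ρ k j z| ≤ 1 := by
  unfold depth
  set f : Fin d → ℤ := fun i => min (z i - loC L a ρ k j i + 1) (hiC L a M ρ k j i + 1 - z i) with hf
  set g : Fin d → ℤ := fun i => min ((z + e μ) i - loC L a ρ k j i + 1) (hiC L a M ρ k j i + 1 - (z + e μ) i) with hg
  have hne : (Finset.univ : Finset (Fin d)).Nonempty := ⟨⟨0, hd⟩, Finset.mem_univ _⟩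
  -- pointwise `|g i − f i| ≤ 1`
  have hpt : ∀ i, g i ≤ f i + 1 ∧ f i ≤ g i + 1 := by
    intro i
    simp only [hf, hg, Pi.add_apply, e]
    by_cases hi : i = μ
    · subst hi; simp only [Pi.single_eq_same]; constructor <;> omega
    · simp only [Pi.single_eq_of_ne hi, add_zero]; constructor <;> linarith
  -- `inf'` is 1-Lipschitz under pointwise 1-closeness
  have hinf : ∀ (u v : Fin d → ℤ), (∀ i, u i ≤ v i + 1) → Finset.univ.inf' hne u ≤ Finset.univ.inf' hne v + 1 := by
    intro u v h
    obtain ⟨i, -, hi⟩ := Finset.exists_mem_eq_inf' hne v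
    rw [hi]
    exact (Finset.inf'_le u (Finset.mem_univ i)).trans (h i)
  have h1 := hinf g f fun i => (hpt i).1
  have h2 := hinf f g fun i => (hpt i).2
  rw [abs_sub_le_iff]
  constructor
  · -- max 0 (inf g) − max 0 (inf f) ≤ 1
    rw [sub_le_iff_le_add]
    exact max_le (by linarith [le_max_left 0 (Finset.univ.inf' hne f)]) (h1.trans (by linarith [le_max_right 0 (Finset.univ.inf' hne f)]))
  · rw [sub_le_iff_le_add]
    exact max_le (by linarith [le_max_left 0 (Finset.univ.inf' hne g)]) (h2.trans (by linarith [le_max_right 0 (Finset.univ.inf' hne g)]))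

/-- **COLLAR RELATION**: a site of `□_{j'}` lies at depth `≥ ρLʲ + 1` in `□_j` for `j < j' ≤ k` (the margins differ by `≥ ρLʲ`).
[cite: Balaban1985RegularSpaces, p.98 («a distance between boundaries of these cubes is equal to R₁M₁Lʲη»)] -/
theorem depth_ge_of_mem_inner (hd : 0 < d) {L : ℕ} (a : Fin d → ℤ) (M ρ : ℕ) {k j j' : ℕ} (hjj : j < j') (hj' : j' ≤ k)
    {z : Fin d → ℤ} (hz : z ∈ cube L a M ρ k j') : (ρ : ℤ) * L ^ j + 1 ≤ depth hd L a M ρ k j z := by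
  rw [mem_cube_iff_inBox a M ρ hj' z] at hz
  have hm := fm_add_le (L := L) (ρ := ρ) hjj hj'
  unfold depth
  rw [le_max_iff]
  right
  rw [Finset.le_inf'_iff]
  intro i _
  obtain ⟨h1, h2⟩ := hz i
  simp only [loC, hiC, bLo, bHi] at h1 h2 ⊢
  have hm' : ((fm L ρ k j' : ℕ) : ℤ) + (ρ : ℤ) * L ^ j ≤ ((fm L ρ k j : ℕ) : ℤ) := by exact_mod_cast hm
  rw [le_min_iff]
  constructor <;> linarith

/-! ## §3 Tower levels of the cube member versus membership in the cubes `□_l` -/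

open B8CubeMemberZd (cubeLamS cubeLamS_of_lt cubeLam inBox_sq_of_mem_cubeLamS)
open B8Eq131Cubes (mem_cube_iff inner_eq_blowup inLo inHi)
open B8Eq131CubesAdmissible (cubeFam cubeFam_false_of_le)
open B8Eq191FlatLettersCubeMember (under_iff_blockMap_eq cubeFam_antitone flm_one_flm blockMap_pow_eq_flm towers_disjoint_cube)
open B8CubeMemberZd (inBox_tower_iff_under)

/-- A site at tower level `j` (truncation `n ≤ k`) lies in `□_j`. [cite: Balaban1985RegularSpaces, (1.5)–(1.6) p.77, (1.131) p.99] -/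
theorem mem_cube_of_tower {L : ℕ} (hL : 1 ≤ L) (a : Fin d → ℤ) (M ρ : ℕ) {k n j : ℕ} {z : Fin d → ℤ}
    (hzj : blockMap (L ^ j) z ∈ cubeLamS L a M ρ k n j) : z ∈ cube L a M ρ k j :=
  (mem_cube_iff hL).mpr ⟨_, inBox_sq_of_mem_cubeLamS hzj, (under_iff_blockMap_eq hL j _ z).mpr rfl⟩

/-- A site at tower level `j < n` (truncation `n ≤ k`) does NOT lie in `□_{j+1}` (`Λ′_j = □_j^{(j)} ∖ □_{j+1}^{(j)}`, and `□_{j+1}` is a union of `Lʲ`-blocks).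
[cite: Balaban1985RegularSpaces, (1.131) p.99, (1.5)–(1.6) p.77] -/
theorem not_mem_cube_succ_of_tower {L : ℕ} (hL : 1 ≤ L) (a : Fin d → ℤ) (M ρ : ℕ) {k n j : ℕ} (hn : n ≤ k) (hj : j < n) {z : Fin d → ℤ}
    (hzj : blockMap (L ^ j) z ∈ cubeLamS L a M ρ k n j) : z ∉ cube L a M ρ k (j + 1) := by
  intro hz
  have hjk : j < k := lt_of_lt_of_le hj hn
  rw [cubeLamS_of_lt L a M ρ k hj] at hzj
  obtain ⟨-, hnot⟩ := hzj
  apply hnot hjk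
  -- `□_{j+1} = Bʲ([inLo j, inHi j])`: the `Lʲ`-label of `z` lies in the inner box, i.e. in the level-1 cube of the family with `k − j` levels
  obtain ⟨w, hw, hwz⟩ := (mem_cube_iff hL).mp hz
  obtain ⟨h1, h2⟩ := inner_eq_blowup (L := L) a M ρ hjk
  have hw' : blockMap (L ^ (j + 1)) z = w := (under_iff_blockMap_eq hL (j + 1) w z).mp hwz
  have hU : B8Ineq132.Under L 1 w (blockMap (L ^ j) z) := by
    rw [under_iff_blockMap_eq hL 1, blockMap_pow_eq_flm, blockMap_pow_eq_flm, flm_one_flm, ← blockMap_pow_eq_flm]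
    exact hw'
  have hlo : sqLo L a ρ k (j + 1) = sqLo L a ρ (k - j) 1 := by unfold sqLo; rw [show k - j - 1 = k - (j + 1) by omega]
  have hhi : sqHi L a M ρ k (j + 1) = sqHi L a M ρ (k - j) 1 := by unfold sqHi; rw [show k - j - 1 = k - (j + 1) by omega]
  have hcube : blockMap (L ^ j) z ∈ cube L a M ρ (k - j) 1 := (mem_cube_iff hL).mpr ⟨w, by rw [← hlo, ← hhi]; exact hw, hU⟩
  rw [h1, h2, hlo, hhi]
  exact hcube

/-- A site at tower level `j ≤ n` lies in `□_l` for every `l ≤ j`. [cite: Balaban1985RegularSpaces, (1.3) p.77, (1.131) p.99] -/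
theorem mem_cube_of_le_tower {L : ℕ} (hL : 1 ≤ L) (a : Fin d → ℤ) (M : ℕ) {ρ : ℕ} (hρ : L ≤ ρ) {k n j l : ℕ} (hn : n ≤ k) (hj : j ≤ n) (hl : l ≤ j)
    {z : Fin d → ℤ} (hzj : blockMap (L ^ j) z ∈ cubeLamS L a M ρ k n j) : z ∈ cube L a M ρ k l := by
  have h := cubeFam_antitone hL a M hρ k hl
  rw [cubeFam_false_of_le L a M ρ (hj.trans hn), cubeFam_false_of_le L a M ρ (hl.trans (hj.trans hn))] at h
  exact h (mem_cube_of_tower hL a M ρ hzj)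

/-- A site at tower level `j < n` lies in NO `□_l` with `j < l ≤ k`. [cite: Balaban1985RegularSpaces, (1.3) p.77, (1.131) p.99] -/
theorem not_mem_cube_of_tower_lt {L : ℕ} (hL : 1 ≤ L) (a : Fin d → ℤ) (M : ℕ) {ρ : ℕ} (hρ : L ≤ ρ) {k n j l : ℕ} (hn : n ≤ k) (hj : j < n)
    (hjl : j < l) (hl : l ≤ k) {z : Fin d → ℤ} (hzj : blockMap (L ^ j) z ∈ cubeLamS L a M ρ k n j) : z ∉ cube L a M ρ k l := by
  intro hz
  have h := cubeFam_antitone hL a M hρ k (Nat.succ_le_of_lt hjl)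
  rw [cubeFam_false_of_le L a M ρ hl, cubeFam_false_of_le L a M ρ (Nat.succ_le_of_lt (lt_of_lt_of_le hj hn))] at h
  exact not_mem_cube_succ_of_tower hL a M ρ hn hj hzj (h hz)

/-! ## §4 The depth potential `F = Σ_{l ≤ n} L⁻ˡ·min(ρLˡ, depth_l)` is bond-Lipschitz at the tower scale -/

/-- **The depth potential** `F(z) = Σ_{l ≤ n} L⁻ˡ·min(ρLˡ, depth_l(z))` — it grows by `ρ` across each collar `□_l ∖ □_{l+1}` and is flat elsewhere.
[cite: Balaban1984PropagatorsII, (2.46) p.231, Lemma 2.1 (2.60)–(2.61) p.234; Balaban1985RegularSpaces, p.98] -/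
def pot (hd : 0 < d) (L : ℕ) (a : Fin d → ℤ) (M ρ k n : ℕ) (z : Fin d → ℤ) : ℝ :=
  ∑ l ∈ Finset.range (n + 1), (((L : ℝ) ^ l))⁻¹ * min ((ρ : ℝ) * (L : ℝ) ^ l) ((depth hd L a M ρ k l z : ℤ) : ℝ)

/-- The depth is non-negative. [cite: Balaban1985RegularSpaces, p.98] -/
theorem depth_nonneg (hd : 0 < d) (L : ℕ) (a : Fin d → ℤ) (M ρ k l : ℕ) (z : Fin d → ℤ) : 0 ≤ depth hd L a M ρ k l z := by
  unfold depth; exact le_max_left _ _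

/-- Term cap: a site of `□_{l'}`, `l < l' ≤ k`, has `min(ρLˡ, depth_l) = ρLˡ`. [cite: Balaban1985RegularSpaces, p.98] -/
theorem term_eq_cap (hd : 0 < d) {L : ℕ} (a : Fin d → ℤ) (M ρ : ℕ) {k l l' : ℕ} (hll : l < l') (hl' : l' ≤ k) {z : Fin d → ℤ}
    (hz : z ∈ cube L a M ρ k l') : min ((ρ : ℝ) * (L : ℝ) ^ l) ((depth hd L a M ρ k l z : ℤ) : ℝ) = (ρ : ℝ) * (L : ℝ) ^ l := by
  have h := depth_ge_of_mem_inner hd a M ρ hll hl' hz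
  have h' : (ρ : ℝ) * (L : ℝ) ^ l ≤ ((depth hd L a M ρ k l z : ℤ) : ℝ) := by
    have : ((ρ : ℤ) * L ^ l : ℤ) ≤ depth hd L a M ρ k l z := by linarith
    exact_mod_cast this
  exact min_eq_left h'

/-- Term cap for a site ONE STEP from `□_{l'}`: if `|depth_l z − depth_l z'| ≤ 1` and `z' ∈ □_{l'}`, `l < l' ≤ k`, then still `min(ρLˡ, depth_l z) = ρLˡ`.
[cite: Balaban1985RegularSpaces, p.98] -/
theorem term_eq_cap_of_close (hd : 0 < d) {L : ℕ} (a : Fin d → ℤ) (M ρ : ℕ) {k l l' : ℕ} (hll : l < l') (hl' : l' ≤ k) {z z' : Fin d → ℤ}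
    (hclose : |depth hd L a M ρ k l z - depth hd L a M ρ k l z'| ≤ 1) (hz' : z' ∈ cube L a M ρ k l') :
    min ((ρ : ℝ) * (L : ℝ) ^ l) ((depth hd L a M ρ k l z : ℤ) : ℝ) = (ρ : ℝ) * (L : ℝ) ^ l := by
  have h := depth_ge_of_mem_inner hd a M ρ hll hl' hz'
  have h2 := (abs_sub_le_iff.mp hclose).2
  have h' : (ρ : ℝ) * (L : ℝ) ^ l ≤ ((depth hd L a M ρ k l z : ℤ) : ℝ) := by
    have : ((ρ : ℤ) * L ^ l : ℤ) ≤ depth hd L a M ρ k l z := by linarith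
    exact_mod_cast this
  exact min_eq_left h'

/-- Term zero: outside `□_l` (`l ≤ k`) the term vanishes. [cite: Balaban1985RegularSpaces, p.98] -/
theorem term_eq_zero (hd : 0 < d) {L : ℕ} (a : Fin d → ℤ) (M ρ : ℕ) {k l : ℕ} (hl : l ≤ k) {z : Fin d → ℤ} (hz : z ∉ cube L a M ρ k l) :
    min ((ρ : ℝ) * (L : ℝ) ^ l) ((depth hd L a M ρ k l z : ℤ) : ℝ) = 0 := by
  rw [mem_cube_iff_one_le_depth hd a M ρ hl] at hz
  have h0 : depth hd L a M ρ k l z = 0 := le_antisymm (by omega) (depth_nonneg hd L a M ρ k l z)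
  rw [h0]; push_cast
  exact min_eq_right (by positivity)

/-- The term `min(ρLˡ, depth_l)` is 1-Lipschitz in the depth. [folklore] [cite: Balaban1984PropagatorsII, (2.46) p.231] -/
theorem abs_term_sub_term_le (hd : 0 < d) (L : ℕ) (a : Fin d → ℤ) (M ρ k l : ℕ) {z z' : Fin d → ℤ}
    (hclose : |depth hd L a M ρ k l z - depth hd L a M ρ k l z'| ≤ 1) :
    |min ((ρ : ℝ) * (L : ℝ) ^ l) ((depth hd L a M ρ k l z : ℤ) : ℝ) - min ((ρ : ℝ) * (L : ℝ) ^ l) ((depth hd L a M ρ k l z' : ℤ) : ℝ)| ≤ 1 := by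
  have h : |((depth hd L a M ρ k l z : ℤ) : ℝ) - ((depth hd L a M ρ k l z' : ℤ) : ℝ)| ≤ 1 := by exact_mod_cast hclose
  calc |min ((ρ : ℝ) * (L : ℝ) ^ l) ((depth hd L a M ρ k l z : ℤ) : ℝ) - min ((ρ : ℝ) * (L : ℝ) ^ l) ((depth hd L a M ρ k l z' : ℤ) : ℝ)|
      ≤ max |(ρ : ℝ) * (L : ℝ) ^ l - (ρ : ℝ) * (L : ℝ) ^ l| |((depth hd L a M ρ k l z : ℤ) : ℝ) - ((depth hd L a M ρ k l z' : ℤ) : ℝ)| :=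
        abs_min_sub_min_le_max _ _ _ _
    _ = |((depth hd L a M ρ k l z : ℤ) : ℝ) - ((depth hd L a M ρ k l z' : ℤ) : ℝ)| := by
        rw [sub_self, abs_zero, max_eq_right (abs_nonneg _)]
    _ ≤ 1 := h

/-- **THE DEPTH POTENTIAL IS BOND-LIPSCHITZ AT THE TOWER SCALE**: if `z₀ ∈ □₀` has tower level `j` (truncation `n ≤ k`) and `z₁` is depth-close to `z₀`
(`|depth_l z₁ − depth_l z₀| ≤ 1` for all `l` — every lattice neighbour is), then `|F(z₁) − F(z₀)| ≤ L⁻ʲ`. Mechanism: the terms `l < j` are capped at both sites, the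
terms `l > j + 1` vanish at both, and of the two terms `l = j, j + 1` at most one moves (if `z₁ ∈ □_{j+1}` then the `j`-term is capped at both).
[cite: Balaban1984PropagatorsII, (2.46) p.231 («A part of Γ contained in Bʲ(Λ_j) consists of bonds of the lattice Λ_j»); Balaban1985RegularSpaces, p.98, (1.131) p.99] -/
theorem abs_pot_sub_pot_le (hd : 0 < d) {L : ℕ} (hL : 1 ≤ L) (a : Fin d → ℤ) (M : ℕ) {ρ : ℕ} (hρ : L ≤ ρ) {k n : ℕ} (hn : n ≤ k)
    {j : ℕ} (hj : j ≤ n) {z₀ z₁ : Fin d → ℤ} (hz₀ : blockMap (L ^ j) z₀ ∈ cubeLamS L a M ρ k n j)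
    (hclose : ∀ l, |depth hd L a M ρ k l z₁ - depth hd L a M ρ k l z₀| ≤ 1) :
    |pot hd L a M ρ k n z₁ - pot hd L a M ρ k n z₀| ≤ (((L : ℝ) ^ j))⁻¹ := by
  have hL0 : (0 : ℝ) < L := by exact_mod_cast hL
  have hρ1 : 1 ≤ ρ := hL.trans hρ
  -- abbreviations for the terms and their differences
  set T : ℕ → (Fin d → ℤ) → ℝ := fun l z => min ((ρ : ℝ) * (L : ℝ) ^ l) ((depth hd L a M ρ k l z : ℤ) : ℝ) with hT
  have hz₀j : z₀ ∈ cube L a M ρ k j := mem_cube_of_tower hL a M ρ hz₀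
  -- (i) terms below `j` are capped at both sites
  have hlow : ∀ l, l < j → T l z₁ - T l z₀ = 0 := by
    intro l hl
    have h0 : T l z₀ = (ρ : ℝ) * (L : ℝ) ^ l := term_eq_cap hd a M ρ hl (hj.trans hn) hz₀j
    have h1 : T l z₁ = (ρ : ℝ) * (L : ℝ) ^ l := term_eq_cap_of_close hd a M ρ hl (hj.trans hn) (hclose l) hz₀j
    rw [h0, h1, sub_self]
  -- (ii) terms above `j + 1` vanish at both sites
  have hhigh : ∀ l, j + 1 < l → l ≤ n → T l z₁ - T l z₀ = 0 := by
    intro l hl hln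
    have hjn : j < n := by omega
    have h0 : z₀ ∉ cube L a M ρ k l := not_mem_cube_of_tower_lt hL a M hρ hn hjn (by omega) (hln.trans hn) hz₀
    have h1 : z₁ ∉ cube L a M ρ k l := by
      intro hz₁
      -- then `z₀` would be deep in `□_{j+1}`
      have hdeep := depth_ge_of_mem_inner hd a M ρ hl (hln.trans hn) hz₁
      have hc := (abs_sub_le_iff.mp (hclose (j + 1))).1
      have hLj : (1 : ℤ) ≤ (ρ : ℤ) * L ^ (j + 1) := by
        have : (1 : ℤ) ≤ L ^ (j + 1) := by exact_mod_cast Nat.one_le_pow _ _ hL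
        nlinarith [show (1 : ℤ) ≤ ρ by exact_mod_cast hρ1]
      have : 1 ≤ depth hd L a M ρ k (j + 1) z₀ := by linarith
      exact not_mem_cube_succ_of_tower hL a M ρ hn hjn hz₀ ((mem_cube_iff_one_le_depth hd a M ρ (by omega) z₀).mpr this)
    rw [show T l z₁ = 0 from term_eq_zero hd a M ρ (hln.trans hn) h1, show T l z₀ = 0 from term_eq_zero hd a M ρ (hln.trans hn) h0, sub_self]
  -- (iii) the two live terms, at most one of which moves
  have hDj : |T j z₁ - T j z₀| ≤ 1 := abs_term_sub_term_le hd L a M ρ k j (hclose j)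
  have hlive : |(((L : ℝ) ^ j))⁻¹ * (T j z₁ - T j z₀) + (if j + 1 ≤ n then (((L : ℝ) ^ (j + 1)))⁻¹ * (T (j + 1) z₁ - T (j + 1) z₀) else 0)|
      ≤ (((L : ℝ) ^ j))⁻¹ := by
    have hLj0 : 0 < ((L : ℝ) ^ j) := pow_pos hL0 j
    have hinvj : 0 ≤ (((L : ℝ) ^ j))⁻¹ := by positivity
    by_cases hjn : j + 1 ≤ n
    · rw [if_pos hjn]
      by_cases hmove : T (j + 1) z₁ - T (j + 1) z₀ = 0
      · rw [hmove, mul_zero, add_zero, abs_mul, abs_of_nonneg hinvj]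
        calc (((L : ℝ) ^ j))⁻¹ * |T j z₁ - T j z₀| ≤ (((L : ℝ) ^ j))⁻¹ * 1 := mul_le_mul_of_nonneg_left hDj hinvj
          _ = _ := mul_one _
      · -- the `(j+1)`-term moves ⇒ `z₁ ∈ □_{j+1}` ⇒ the `j`-term is capped at both sites
        have hz₀' : z₀ ∉ cube L a M ρ k (j + 1) := not_mem_cube_succ_of_tower hL a M ρ hn (by omega) hz₀
        have hz₁ : z₁ ∈ cube L a M ρ k (j + 1) := by
          by_contra h1
          exact hmove (by rw [show T (j + 1) z₁ = 0 from term_eq_zero hd a M ρ (hjn.trans hn) h1,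
            show T (j + 1) z₀ = 0 from term_eq_zero hd a M ρ (hjn.trans hn) hz₀', sub_self])
        have hcap0 : T j z₀ = (ρ : ℝ) * (L : ℝ) ^ j := by
          refine term_eq_cap_of_close hd a M ρ (Nat.lt_succ_self j) (hjn.trans hn) ?_ hz₁
          rw [abs_sub_comm]; exact hclose j
        have hcap1 : T j z₁ = (ρ : ℝ) * (L : ℝ) ^ j := term_eq_cap hd a M ρ (Nat.lt_succ_self j) (hjn.trans hn) hz₁
        rw [hcap0, hcap1, sub_self, mul_zero, zero_add, abs_mul, abs_of_nonneg (by positivity)]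
        have hD1 : |T (j + 1) z₁ - T (j + 1) z₀| ≤ 1 := abs_term_sub_term_le hd L a M ρ k (j + 1) (hclose (j + 1))
        calc (((L : ℝ) ^ (j + 1)))⁻¹ * |T (j + 1) z₁ - T (j + 1) z₀| ≤ (((L : ℝ) ^ (j + 1)))⁻¹ * 1 :=
              mul_le_mul_of_nonneg_left hD1 (by positivity)
          _ ≤ (((L : ℝ) ^ j))⁻¹ := by
              rw [mul_one]
              exact inv_anti₀ hLj0 (pow_le_pow_right₀ (by exact_mod_cast hL) (Nat.le_succ j))
    · rw [if_neg hjn, add_zero, abs_mul, abs_of_nonneg hinvj]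
      calc (((L : ℝ) ^ j))⁻¹ * |T j z₁ - T j z₀| ≤ (((L : ℝ) ^ j))⁻¹ * 1 := mul_le_mul_of_nonneg_left hDj hinvj
        _ = _ := mul_one _
  -- (iv) the difference of the potentials is the sum of the two live terms
  have hsum : pot hd L a M ρ k n z₁ - pot hd L a M ρ k n z₀
      = (((L : ℝ) ^ j))⁻¹ * (T j z₁ - T j z₀) + (if j + 1 ≤ n then (((L : ℝ) ^ (j + 1)))⁻¹ * (T (j + 1) z₁ - T (j + 1) z₀) else 0) := by
    unfold pot
    rw [← Finset.sum_sub_distrib]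
    have hterm : ∀ l ∈ Finset.range (n + 1),
        (((L : ℝ) ^ l))⁻¹ * min ((ρ : ℝ) * (L : ℝ) ^ l) ((depth hd L a M ρ k l z₁ : ℤ) : ℝ)
          - (((L : ℝ) ^ l))⁻¹ * min ((ρ : ℝ) * (L : ℝ) ^ l) ((depth hd L a M ρ k l z₀ : ℤ) : ℝ)
        = (if l = j then (((L : ℝ) ^ j))⁻¹ * (T j z₁ - T j z₀) else 0)
          + (if l = j + 1 then (((L : ℝ) ^ (j + 1)))⁻¹ * (T (j + 1) z₁ - T (j + 1) z₀) else 0) := by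
      intro l hl
      have hln : l ≤ n := Nat.lt_succ_iff.mp (Finset.mem_range.mp hl)
      have hTl : (((L : ℝ) ^ l))⁻¹ * min ((ρ : ℝ) * (L : ℝ) ^ l) ((depth hd L a M ρ k l z₁ : ℤ) : ℝ)
          - (((L : ℝ) ^ l))⁻¹ * min ((ρ : ℝ) * (L : ℝ) ^ l) ((depth hd L a M ρ k l z₀ : ℤ) : ℝ)
          = (((L : ℝ) ^ l))⁻¹ * (T l z₁ - T l z₀) := by simp only [hT]; ring
      rw [hTl]
      by_cases h1 : l = j
      · subst h1; rw [if_pos rfl, if_neg (by omega), add_zero]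
      · by_cases h2 : l = j + 1
        · subst h2; rw [if_neg h1, if_pos rfl, zero_add]
        · rw [if_neg h1, if_neg h2, add_zero]
          rcases lt_or_gt_of_ne h1 with hlt | hgt
          · rw [hlow l hlt, mul_zero]
          · rw [hhigh l (by omega) hln, mul_zero]
    rw [Finset.sum_congr rfl hterm, Finset.sum_add_distrib, Finset.sum_ite_eq' (Finset.range (n + 1)) j,
      Finset.sum_ite_eq' (Finset.range (n + 1)) (j + 1), if_pos (Finset.mem_range.mpr (Nat.lt_succ_of_le hj))]
    by_cases hjn : j + 1 ≤ n
    · rw [if_pos (Finset.mem_range.mpr (Nat.lt_succ_of_le hjn)), if_pos hjn]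
    · rw [if_neg (fun h => hjn (Nat.lt_succ_iff.mp (Finset.mem_range.mp h))), if_neg hjn]
  rw [hsum]
  exact hlive

/-- The value of the potential at a site of tower level `j`: `ρ·j ≤ F(z) ≤ ρ·(j + 1)`. [cite: Balaban1984PropagatorsII, (2.46) p.231; Balaban1985RegularSpaces, p.98] -/
theorem pot_bounds (hd : 0 < d) {L : ℕ} (hL : 1 ≤ L) (a : Fin d → ℤ) (M : ℕ) {ρ : ℕ} (hρ : L ≤ ρ) {k n : ℕ} (hn : n ≤ k)
    {j : ℕ} (hj : j ≤ n) {z : Fin d → ℤ} (hz : blockMap (L ^ j) z ∈ cubeLamS L a M ρ k n j) :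
    (ρ : ℝ) * j ≤ pot hd L a M ρ k n z ∧ pot hd L a M ρ k n z ≤ (ρ : ℝ) * (j + 1) := by
  have hL0 : (0 : ℝ) < L := by exact_mod_cast hL
  have hzj : z ∈ cube L a M ρ k j := mem_cube_of_tower hL a M ρ hz
  -- termwise: `ρ` below `j`, in `[0, ρ]` at `j`, `0` above
  have hterm : ∀ l ∈ Finset.range (n + 1),
      (if l < j then (ρ : ℝ) else 0) ≤ (((L : ℝ) ^ l))⁻¹ * min ((ρ : ℝ) * (L : ℝ) ^ l) ((depth hd L a M ρ k l z : ℤ) : ℝ)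
      ∧ (((L : ℝ) ^ l))⁻¹ * min ((ρ : ℝ) * (L : ℝ) ^ l) ((depth hd L a M ρ k l z : ℤ) : ℝ) ≤ (if l ≤ j then (ρ : ℝ) else 0) := by
    intro l hl
    have hln : l ≤ n := Nat.lt_succ_iff.mp (Finset.mem_range.mp hl)
    have hLl : 0 < ((L : ℝ) ^ l) := pow_pos hL0 l
    have hcapval : (((L : ℝ) ^ l))⁻¹ * ((ρ : ℝ) * (L : ℝ) ^ l) = ρ := by field_simp
    have hmin_le : (((L : ℝ) ^ l))⁻¹ * min ((ρ : ℝ) * (L : ℝ) ^ l) ((depth hd L a M ρ k l z : ℤ) : ℝ) ≤ ρ :=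
      calc (((L : ℝ) ^ l))⁻¹ * min ((ρ : ℝ) * (L : ℝ) ^ l) ((depth hd L a M ρ k l z : ℤ) : ℝ)
          ≤ (((L : ℝ) ^ l))⁻¹ * ((ρ : ℝ) * (L : ℝ) ^ l) := mul_le_mul_of_nonneg_left (min_le_left _ _) (by positivity)
        _ = ρ := hcapval
    have hmin_nn : 0 ≤ (((L : ℝ) ^ l))⁻¹ * min ((ρ : ℝ) * (L : ℝ) ^ l) ((depth hd L a M ρ k l z : ℤ) : ℝ) :=
      mul_nonneg (by positivity) (le_min (by positivity) (by exact_mod_cast depth_nonneg hd L a M ρ k l z))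
    constructor
    · split_ifs with hlj
      · rw [term_eq_cap hd a M ρ hlj (hj.trans hn) hzj, hcapval]
      · exact hmin_nn
    · split_ifs with hlj
      · exact hmin_le
      · have hjl : j < l := not_le.mp hlj
        have hjn : j < n := lt_of_lt_of_le hjl hln
        rw [term_eq_zero hd a M ρ (hln.trans hn) (not_mem_cube_of_tower_lt hL a M hρ hn hjn hjl (hln.trans hn) hz), mul_zero]
  have hflt : (Finset.range (n + 1)).filter (fun l => l < j) = Finset.range j := by
    ext l; simp only [Finset.mem_filter, Finset.mem_range]; omega
  have hfle : (Finset.range (n + 1)).filter (fun l => l ≤ j) = Finset.range (j + 1) := by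
    ext l; simp only [Finset.mem_filter, Finset.mem_range]; omega
  have hs1 : ∑ l ∈ Finset.range (n + 1), (if l < j then (ρ : ℝ) else 0) = (ρ : ℝ) * j := by
    rw [← Finset.sum_filter, hflt, Finset.sum_const, Finset.card_range, nsmul_eq_mul, mul_comm]
  have hs2 : ∑ l ∈ Finset.range (n + 1), (if l ≤ j then (ρ : ℝ) else 0) = (ρ : ℝ) * (j + 1) := by
    rw [← Finset.sum_filter, hfle, Finset.sum_const, Finset.card_range, nsmul_eq_mul, mul_comm]; push_cast; ring
  unfold pot
  constructor
  · rw [← hs1]; exact Finset.sum_le_sum fun l hl => (hterm l hl).1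
  · rw [← hs2]; exact Finset.sum_le_sum fun l hl => (hterm l hl).2

/-! ## §5 The collar lower bound of the scaled site distance on the cube member -/

open B8Eq191FlatDirichletDistance (nnGraph lsDist abs_sub_le_lsDist towerScale_eq adj_add_e adj_sub_e)
open B8Eq191FlatDirichletConjugation (cover_cubeMember)

open Classical in
/-- **THE DEPTH POTENTIAL IS A TEST FUNCTION FOR THE TOWER-SCALED DISTANCE**: on `S = □₀` with the tower scale `σ = Σ_j[Bʲ(·)∈Λs_n(j)]L⁻ʲ`,
`|F(u) − F(v)| ≤ min(σ u, σ v)` across every bond of the region graph. [cite: Balaban1984PropagatorsII, (2.46) p.231; Balaban1985RegularSpaces, (1.131) p.99] -/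
theorem pot_testFunction (hd : 0 < d) {L : ℕ} (hL : 1 ≤ L) (a : Fin d → ℤ) (M : ℕ) {ρ : ℕ} (hρ : L ≤ ρ) {k n : ℕ} (hn : n ≤ k)
    (S : Finset (Fin d → ℤ)) (hS : ∀ x, x ∈ S ↔ x ∈ cubeFam false L a M ρ k 0) (u v : Fin d → ℤ) (huv : (nnGraph S).Adj u v) :
    |pot hd L a M ρ k n u - pot hd L a M ρ k n v|
      ≤ min (∑ j' ∈ Finset.range (n + 1), (if blockMap (L ^ j') u ∈ cubeLamS L a M ρ k n j' then (((L : ℝ) ^ j'))⁻¹ else 0))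
            (∑ j' ∈ Finset.range (n + 1), (if blockMap (L ^ j') v ∈ cubeLamS L a M ρ k n j' then (((L : ℝ) ^ j'))⁻¹ else 0)) := by
  obtain ⟨hu, hv, -, μ, hμ⟩ := huv
  have hdisj : ∀ x ∈ S, ∀ j, j ≤ n → ∀ j', j' ≤ n → blockMap (L ^ j) x ∈ cubeLamS L a M ρ k n j →
      blockMap (L ^ j') x ∈ cubeLamS L a M ρ k n j' → j = j' :=
    fun x hx j hj j' hj' h1 h2 => (towers_disjoint_cube hL a M hρ hn j hj j' hj' _ h1 _ h2 x ((hS x).mp hx) rfl rfl).1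
  -- depth-closeness of lattice neighbours, in both orientations
  have hclose_uv : ∀ l, |depth hd L a M ρ k l v - depth hd L a M ρ k l u| ≤ 1 := by
    intro l
    rcases hμ with h | h
    · rw [h]; exact abs_depth_sub_depth_le_one hd L a M ρ k l u μ
    · rw [h, abs_sub_comm]; exact abs_depth_sub_depth_le_one hd L a M ρ k l v μ
  have hclose_vu : ∀ l, |depth hd L a M ρ k l u - depth hd L a M ρ k l v| ≤ 1 := fun l => by rw [abs_sub_comm]; exact hclose_uv l
  obtain ⟨ju, hju, huj⟩ := cover_cubeMember hL a M hρ hn u ((hS u).mp hu)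
  obtain ⟨jv, hjv, hvj⟩ := cover_cubeMember hL a M hρ hn v ((hS v).mp hv)
  rw [towerScale_eq S L n (cubeLamS L a M ρ k n) hdisj hu hju huj, towerScale_eq S L n (cubeLamS L a M ρ k n) hdisj hv hjv hvj]
  refine le_min ?_ ?_
  · rw [abs_sub_comm]; exact abs_pot_sub_pot_le hd hL a M hρ hn hju huj hclose_uv
  · exact abs_pot_sub_pot_le hd hL a M hρ hn hjv hvj hclose_vu

/-- **Reachability inside a box-shaped region**: any two sites of `S = [lo, hi]` are joined by a nearest-neighbour walk in `S` (coordinate by coordinate).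
[folklore] [cite: Balaban1984PropagatorsII, (2.46) p.231] -/
theorem reachable_of_inBox (S : Finset (Fin d → ℤ)) {lo hi : Fin d → ℤ} (hS : ∀ x, x ∈ S ↔ InBox lo hi x) :
    ∀ (m : ℕ) (x z : Fin d → ℤ), x ∈ S → z ∈ S → (∑ i : Fin d, |x i - z i|) = (m : ℤ) → (nnGraph S).Reachable x z := by
  intro m
  induction m with
  | zero =>
    intro x z hx hz hm
    have hxz : x = z := by
      funext i
      have h0 : |x i - z i| = 0 := by
        have hle : |x i - z i| ≤ ∑ i : Fin d, |x i - z i| := Finset.single_le_sum (fun i _ => abs_nonneg (x i - z i)) (Finset.mem_univ i)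
        have : (∑ i : Fin d, |x i - z i|) = 0 := by rw [hm]; simp
        linarith [abs_nonneg (x i - z i)]
      linarith [abs_eq_zero.mp h0]
    subst hxz
    exact SimpleGraph.Reachable.refl _
  | succ m ih =>
    intro x z hx hz hm
    have hpos : 0 < ∑ i : Fin d, |x i - z i| := by rw [hm]; positivity
    obtain ⟨i, -, hi⟩ := Finset.exists_lt_of_sum_lt (s := (Finset.univ : Finset (Fin d))) (f := fun _ => (0 : ℤ))
      (g := fun i => |x i - z i|) (by simpa using hpos)
    have hi' : 0 < |x i - z i| := by simpa using hi
    have hne : x i ≠ z i := fun h => by simp [h] at hi'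
    have hxB := (hS x).mp hx
    have hzB := (hS z).mp hz
    rcases lt_or_gt_of_ne hne with hlt | hgt
    · -- step `x → x + e_i` (stays in the box: `x_i < z_i ≤ hi_i`)
      have hx' : x + e i ∈ S := by
        refine (hS _).mpr fun ν => ?_
        by_cases hν : ν = i
        · subst hν; simp only [Pi.add_apply, e, Pi.single_eq_same]; exact ⟨by linarith [(hxB ν).1], by linarith [(hzB ν).2]⟩
        · simp only [Pi.add_apply, e, Pi.single_eq_of_ne hν, add_zero]; exact hxB ν
      have hsum : (∑ ν : Fin d, |(x + e i) ν - z ν|) = (m : ℤ) := by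
        have hsplit : ∀ ν : Fin d, |(x + e i) ν - z ν| = |x ν - z ν| - (if ν = i then 1 else 0) := by
          intro ν
          by_cases hν : ν = i
          · subst hν
            simp only [Pi.add_apply, e, Pi.single_eq_same, if_true]
            rw [abs_of_nonpos (by linarith), abs_of_neg (by linarith)]
            ring
          · simp only [Pi.add_apply, e, Pi.single_eq_of_ne hν, add_zero, if_neg hν, sub_zero]
        rw [Finset.sum_congr rfl fun ν _ => hsplit ν, Finset.sum_sub_distrib, Finset.sum_ite_eq' Finset.univ i, if_pos (Finset.mem_univ i)]
        have : (∑ ν : Fin d, |x ν - z ν|) = (m : ℤ) + 1 := by rw [hm]; push_cast; ring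
        linarith
      exact (adj_add_e S hx i hx').reachable.trans (ih (x + e i) z hx' hz hsum)
    · -- step `z → z + e_i` towards `x`, then symmetry
      have hz' : z + e i ∈ S := by
        refine (hS _).mpr fun ν => ?_
        by_cases hν : ν = i
        · subst hν; simp only [Pi.add_apply, e, Pi.single_eq_same]; exact ⟨by linarith [(hzB ν).1], by linarith [(hxB ν).2]⟩
        · simp only [Pi.add_apply, e, Pi.single_eq_of_ne hν, add_zero]; exact hzB ν
      have hsum : (∑ ν : Fin d, |x ν - (z + e i) ν|) = (m : ℤ) := by
        have hsplit : ∀ ν : Fin d, |x ν - (z + e i) ν| = |x ν - z ν| - (if ν = i then 1 else 0) := by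
          intro ν
          by_cases hν : ν = i
          · subst hν
            simp only [Pi.add_apply, e, Pi.single_eq_same, if_true]
            rw [abs_of_nonneg (by linarith), abs_of_pos (by linarith)]
            ring
          · simp only [Pi.add_apply, e, Pi.single_eq_of_ne hν, add_zero, if_neg hν, sub_zero]
        rw [Finset.sum_congr rfl fun ν _ => hsplit ν, Finset.sum_sub_distrib, Finset.sum_ite_eq' Finset.univ i, if_pos (Finset.mem_univ i)]
        have : (∑ ν : Fin d, |x ν - z ν|) = (m : ℤ) + 1 := by rw [hm]; push_cast; ring
        linarith
      exact (ih x (z + e i) hx hz' hsum).trans (adj_add_e S hz i hz').reachable.symm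

/-- Any two sites of `□₀` are reachable from each other in the region graph of `S = □₀`. [cite: Balaban1984PropagatorsII, (2.46) p.231; Balaban1985RegularSpaces, p.98] -/
theorem reachable_cubeMember {L : ℕ} (a : Fin d → ℤ) (M ρ k : ℕ) (S : Finset (Fin d → ℤ)) (hS : ∀ x, x ∈ S ↔ x ∈ cubeFam false L a M ρ k 0)
    {x z : Fin d → ℤ} (hx : x ∈ S) (hz : z ∈ S) : (nnGraph S).Reachable x z := by
  have hS' : ∀ y, y ∈ S ↔ InBox (loC L a ρ k 0) (hiC L a M ρ k 0) y := by
    intro y; rw [hS y, cubeFam_false_of_le L a M ρ (Nat.zero_le k), mem_cube_iff_inBox a M ρ (Nat.zero_le k)]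
  exact reachable_of_inBox S hS' ((∑ i : Fin d, |x i - z i|).toNat) x z hx hz
    (by rw [Int.toNat_of_nonneg (Finset.sum_nonneg fun i _ => abs_nonneg _)])

open Classical in
/-- **THE COLLAR LOWER BOUND OF THE TOWER-SCALED SITE DISTANCE** (brick 4b): on the cube member (`S = □₀`, truncation `n ≤ k`, collar width `ρ ≥ L`), two sites at
tower levels `jₓ`, `j_z` are at scaled distance `d_σ(x, z) ≥ ρ·(|jₓ − j_z| − 1)` — every walk must cross the `|jₓ − j_z| − 1` full collars between them, each `ρ` coarse
blocks thick ([B6] (2.2) «(Lʲη)⁻¹dist(Ω_jᶜ, Ω_{j+1}) > RM»; B8 p.98 «a distance between boundaries of these cubes is equal to R₁M₁Lʲη»).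
[cite: Balaban1984PropagatorsII, (2.2) p.224, (2.46) p.231, Lemma 2.1 (2.60)–(2.61) p.234; Balaban1985RegularSpaces, p.98, (1.131) p.99] -/
theorem lsDist_ge_collars (hd : 0 < d) {L : ℕ} (hL : 1 ≤ L) (a : Fin d → ℤ) (M : ℕ) {ρ : ℕ} (hρ : L ≤ ρ) {k n : ℕ} (hn : n ≤ k)
    (S : Finset (Fin d → ℤ)) (hS : ∀ x, x ∈ S ↔ x ∈ cubeFam false L a M ρ k 0)
    {x z : Fin d → ℤ} (hx : x ∈ S) (hz : z ∈ S) {jx jz : ℕ} (hjx : jx ≤ n) (hjz : jz ≤ n)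
    (hxj : blockMap (L ^ jx) x ∈ cubeLamS L a M ρ k n jx) (hzj : blockMap (L ^ jz) z ∈ cubeLamS L a M ρ k n jz) :
    (ρ : ℝ) * (|(jx : ℝ) - jz| - 1)
      ≤ lsDist S (fun y => ∑ j' ∈ Finset.range (n + 1), (if blockMap (L ^ j') y ∈ cubeLamS L a M ρ k n j' then (((L : ℝ) ^ j'))⁻¹ else 0)) x z := by
  have htest := abs_sub_le_lsDist S (σ := fun y => ∑ j' ∈ Finset.range (n + 1),
      (if blockMap (L ^ j') y ∈ cubeLamS L a M ρ k n j' then (((L : ℝ) ^ j'))⁻¹ else 0))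
    (pot hd L a M ρ k n) (fun u v huv => pot_testFunction hd hL a M hρ hn S hS u v huv) (reachable_cubeMember a M ρ k S hS hx hz)
  obtain ⟨hx1, hx2⟩ := pot_bounds hd hL a M hρ hn hjx hxj
  obtain ⟨hz1, hz2⟩ := pot_bounds hd hL a M hρ hn hjz hzj
  have hρ0 : (0 : ℝ) ≤ ρ := by positivity
  refine le_trans ?_ htest
  rcases le_total (jx : ℝ) jz with h | h
  · calc (ρ : ℝ) * (|(jx : ℝ) - jz| - 1) = (ρ : ℝ) * jz - (ρ : ℝ) * jx - ρ := by
          rw [abs_of_nonpos (sub_nonpos.mpr h)]; ring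
      _ ≤ pot hd L a M ρ k n z - pot hd L a M ρ k n x := by linarith
      _ ≤ |pot hd L a M ρ k n x - pot hd L a M ρ k n z| := by rw [abs_sub_comm]; exact le_abs_self _
  · calc (ρ : ℝ) * (|(jx : ℝ) - jz| - 1) = (ρ : ℝ) * jx - (ρ : ℝ) * jz - ρ := by
          rw [abs_of_nonneg (sub_nonneg.mpr h)]; ring
      _ ≤ pot hd L a M ρ k n x - pot hd L a M ρ k n z := by linarith
      _ ≤ |pot hd L a M ρ k n x - pot hd L a M ρ k n z| := le_abs_self _

end Literature.MathematicalPhysics.QuantumFieldTheory.Balaban1983to89.B8Eq191FlatDirichletDepth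

end
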